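import Summits.QuantumFields.YangMills.Theses.SquareRootCeilings
import Summits.QuantumFields.YangMills.Theorems.OnsetCalibrationOnsetVanishes

/-!
# Route `SquareRootCeilings` (ym-idea-11 g3): the assembly item is provable now

`assembly_proof : Assembly` (item stmt-QuantumFields-26674):
`Assembly = SqrtDomination → SubOnsetTwoPointCeilings → DominationTransfer → FactorialCalibrationC → OnsetFloorsC → leaf`,
and `FactorialCalibrationC` unfolds to `FactorialSubOnsetCeilings → OnsetFloors → OnsetVanishes → leaf` whose middle residual
`OnsetCalibration.OnsetVanishes` is the landed theorem
`Summit.QuantumFields.YangMills.Theorems.OnsetCalibration.onsetVanishes_proof`; `DominationTransfer K1 K2` is exactly the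
antecedent of `FactorialCalibration`. Pure bookkeeping: no crux is touched and no summit, leg or leaf is proved by this file.
-/

set_option autoImplicit false

namespace Summit.QuantumFields.YangMills.Theses.SquareRootCeilings

/-- item stmt-QuantumFields-26674 (`Assembly`) of route `SquareRootCeilings`, proved by composition. -/
theorem assembly_proof : Assembly :=
  fun hD hT hX hC hF =>
    hC (hX hT hD) hF Summit.QuantumFields.YangMills.Theorems.OnsetCalibration.onsetVanishes_proof

end Summit.QuantumFields.YangMills.Theses.SquareRootCeilings
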